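/-
Copyright (c) 2026 the pub-hodgecm-mathlib formalisation cell (harness21).  Prover seat hodgecm-mathlib-F0P3b-p01 (g13): «S3-ram» seeding wave (LEAD F0P3a-plan (g12);
owner F0P3a-p06 (g15); architect A-p16 (g31)), row «(Σ)′ ASSEMBLY modulo (J★)» of the type-(1) row (e1); 2026-09-02.
-/
import Literature.NumberTheory.Rogawski1990.UnitFundamentalLemmaRamifiedFramedReduction          -- ★ p847459 (this seat): (a′); brings ★ Sockets (E)(Lit)(Lit⁺)
import Literature.NumberTheory.Rogawski1990.DepthZeroKappaTransferTypeOneRamifiedSignDictionary   -- ★ p847416 (B-p14): (Dict) `quadraticChar_residue_eq_hilbertSymbol_of_ramified`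
import Literature.NumberTheory.Automorphic.UnitaryDepthZeroPieceStrataLatticeFrameRamified       -- ★ p847430 (F0P3a-p05): A1‴ `classOrbitalIntegral_eq_mul_latticeStrata_formCongr_of_vDeep_ramified` (brings A1∘A1′ ★ p847411, ★ p847154)
import Literature.NumberTheory.Rogawski1990.DepthZeroKappaTransferTypeTwoGSide                      -- ★ `setOf_entrywise_deep_mem_nhds_one` (the entrywise-deep neighbourhood of `1 ∈ H_v`)
import Literature.NumberTheory.Rogawski1990.LocalTransferLinear                                  -- ★ `isRegularElt_of_isLocalNormPair`
import Literature.NumberTheory.Automorphic.LocalUnitaryEllipticCentralizerCompact                  -- ★ `compactSpace_centralizer_cmDatum_local_of_conj_eq_diagonal`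
import Literature.NumberTheory.Automorphic.CongruenceSubgroupExpansionGL                           -- ★ `valBound_coe_conj_sub_one`
import Literature.NumberTheory.Automorphic.ProjectiveDescentLatticeLevelsDischarge                 -- ★ `valued_toPlace_eq_pow_two_of_ramified`
import Literature.NumberTheory.Automorphic.UnitaryGroupIntegralPointsReductionRamified             -- ★ `natCard_residueField_eq_of_ramified`
import Literature.NumberTheory.Automorphic.ValuedFieldValuativeRelBridge                           -- ★ `valuedInteger_eq_integer`, `v_le_iff_valuation_le`, `v_eq_one_iff_valuation_eq_one`
import Literature.NumberTheory.Automorphic.HeckeTransversalGL                                      -- ★ `valuation_det_eq_one_of_mem_glInt`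
import Mathlib.NumberTheory.LegendreSymbol.QuadraticChar.Basic
import HarnessLib

/-!
# (Σ)′ modulo (J★): the κ-signed class sum of a `v`-level-1 piece over the four ramified type-(1) literals, from the junction (Rogawski 1990 §4.9)

Topic `NumberTheory/Rogawski1990`; namespace `Literature.NumberTheory.Rogawski1990`.  ONE THEOREM (no definition, no named fact, no instance, no notation, no `sorry`).
Cell `pub/hodgecm-mathlib`, crux H413 (`--supports stmt-HodgeConjecture-24833`), «S3-ram» seeding wave; dealt by A-p16 (g31) 00:43:37Z (09-02).
`typeOne_signedClassSum_ram_of_junction` : binders = socket (Σ)′ of skeleton v6.2 (`stub_typeOne_signedClassSum_ram` :126, sha16 749cacd6d1c94b79) VERBATIM + ONE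
hypothesis `hJ` = the junction head (J★) of F0P3a-p01 (g16) (statement-first v3 04fe0ed23a1e21a7 :42–:87) ∀-closed over its abstract model
`K σ ϖ … u₀ u₁ u₂ ε c₀ α u γ T N₁ N₂ N m n A C`; conclusion = (Σ)′ VERBATIM.  Hypotheses-as-binders: lands before (J★); when (J★) is ★ the fold passes its name.
HONEST LABEL: HC_CM is proved only modulo the 2 remaining named inputs (hLiu418 24832, h413 24833) until rung 0 closes; no books consequence.

## References
* [Rogawski1990] J. D. Rogawski, *Automorphic Representations of Unitary Groups in Three Variables*, Ann. of Math. Stud. 123 (1990), §4.9 Prop. 4.9.1 (a) p. 55,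
  pp. 54–56; §4.3 (4.3.1)–(4.3.2) p. 43.
* [Kottwitz1986] R. Kottwitz, *Base change for unit elements of Hecke algebras*, Compositio Math. 60 (1986), §3.
* [LabesseLanglands1979] J.-P. Labesse, R. P. Langlands, *L-indistinguishability for SL(2)*, Canad. J. Math. 31 (1979), §2 Lemma 2.1.
-/

set_option autoImplicit false

noncomputable section

open MeasureTheory Measure Set Function NumberField IsDedekindDomain Matrix Polynomial Topology Filter Finset
open Literature.NumberTheory.Automorphic Literature.NumberTheory.Automorphic.UnitaryGroup
open Literature.NumberTheory.Automorphic.IntegralReduction Literature.NumberTheory.GaloisRepresentations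
open Literature.NumberTheory.GaloisRepresentations.IsNonarchimedeanLocalField Literature.NumberTheory.QuadraticForms
open Literature.NumberTheory.NumberFields
open Literature.NumberTheory.Automorphic.UnitaryLatticeTree Literature.NumberTheory.Automorphic.HermitianLattice
open Literature.AlgebraicGeometry.ShimuraVarieties (unitaryGroup)
open Literature.NumberTheory.Automorphic.IntegralReduction ValuativeRel
open scoped Matrix MatrixGroups ValuativeRel WithZero

namespace Literature.NumberTheory.Rogawski1990

section SignedClassSum

/-! ## §0 Helpers: `|x| = |ϖ|^N`; 2-deep roots of an entrywise `ϖ⁴`-deep `2×2` matrix; `quadraticChar` along a ring isomorphism; the two integer rings of `L_w` -/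

/-- `x ≠ 0` with `|x| ≤ 1` has `|x| = |ϖ|^N` for some `N : ℕ` (`ϖ` a uniformiser). [folklore] -/
private theorem exists_nat_v_eq_v_pow {K : Type*} [Field K] [Valued K ℤᵐ⁰] {ϖ x : K} (hϖ : Valued.v ϖ = WithZero.exp (-1 : ℤ)) (hx : x ≠ 0)
    (hx1 : Valued.v x ≤ 1) : ∃ N : ℕ, Valued.v x = Valued.v ϖ ^ N := by
  have hv0 : Valued.v x ≠ 0 := (Valuation.ne_zero_iff _).2 hx
  have hlog : WithZero.log (Valued.v x) ≤ 0 := by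
    rw [← WithZero.exp_le_exp, WithZero.exp_log hv0, WithZero.exp_zero]; exact hx1
  refine ⟨(-WithZero.log (Valued.v x)).toNat, ?_⟩
  rw [hϖ, ← WithZero.exp_nsmul]
  conv_lhs => rw [← WithZero.exp_log hv0]
  rw [WithZero.exp_inj]
  have h := Int.toNat_of_nonneg (show 0 ≤ -WithZero.log (Valued.v x) by omega)
  simp only [nsmul_eq_mul, mul_neg, mul_one]
  omega

/-- A norm-one root `ξ` of the characteristic polynomial of an entrywise `ϖ⁴`-deep `2×2` matrix is `ϖ²`-deep: `(ξ−1)² = (tr−2)ξ − (det−1)`.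
[cite: Rogawski1990, §4.9 p. 55] -/
theorem v_sub_one_le_of_isRoot_charpoly_two {K : Type*} [Field K] [Valued K ℤᵐ⁰] {ϖ : K} (hϖ : Valued.v ϖ = WithZero.exp (-1 : ℤ))
    (G : Matrix (Fin 2) (Fin 2) K) (hG : ∀ i j, Valued.v ((G - 1) i j) ≤ Valued.v (ϖ ^ 4)) {ξ : K} (hξ : Valued.v ξ = 1) (hr : G.charpoly.IsRoot ξ) :
    Valued.v (ξ - 1) ≤ Valued.v ϖ ^ 2 := by
  simp only [Valuation.map_pow] at hG
  have h00 : Valued.v (G 0 0 - 1) ≤ Valued.v ϖ ^ 4 := by have h := hG 0 0; rwa [Matrix.sub_apply, Matrix.one_apply_eq] at h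
  have h11 : Valued.v (G 1 1 - 1) ≤ Valued.v ϖ ^ 4 := by have h := hG 1 1; rwa [Matrix.sub_apply, Matrix.one_apply_eq] at h
  have h01 : Valued.v (G 0 1) ≤ Valued.v ϖ ^ 4 := by
    have h := hG 0 1; rwa [Matrix.sub_apply, Matrix.one_apply_ne (by decide), sub_zero] at h
  have h10 : Valued.v (G 1 0) ≤ Valued.v ϖ ^ 4 := by
    have h := hG 1 0; rwa [Matrix.sub_apply, Matrix.one_apply_ne (by decide), sub_zero] at h
  have hϖlt : Valued.v ϖ < 1 := by rw [hϖ, ← WithZero.exp_zero]; exact WithZero.exp_lt_exp.2 (by norm_num)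
  have hϖ4le1 : Valued.v ϖ ^ 4 ≤ 1 := pow_le_one₀ zero_le hϖlt.le
  have hmul : ∀ {x y : K}, Valued.v x ≤ Valued.v ϖ ^ 4 → Valued.v y ≤ Valued.v ϖ ^ 4 → Valued.v (x * y) ≤ Valued.v ϖ ^ 4 := fun hx hy => by
    rw [Valuation.map_mul]
    calc _ ≤ Valued.v ϖ ^ 4 * 1 := mul_le_mul' hx (hy.trans hϖ4le1)
      _ = _ := mul_one _
  have hsq : (ξ - 1) * (ξ - 1) = ((G 0 0 - 1) + (G 1 1 - 1)) * ξ - ((G 0 0 - 1) * (G 1 1 - 1) + ((G 0 0 - 1) + (G 1 1 - 1)) - G 0 1 * G 1 0) := by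
    rw [Polynomial.IsRoot.def, Matrix.charpoly_fin_two, Polynomial.eval_add, Polynomial.eval_sub, Polynomial.eval_mul, Polynomial.eval_pow, Polynomial.eval_C,
      Polynomial.eval_X, Polynomial.eval_C, Matrix.trace_fin_two, Matrix.det_fin_two] at hr
    linear_combination hr
  have hv2 : Valued.v (ξ - 1) * Valued.v (ξ - 1) ≤ Valued.v ϖ ^ 4 := by
    rw [← Valuation.map_mul, hsq]
    refine (Valuation.map_sub _ _ _).trans (max_le ?_ ?_)
    · rw [Valuation.map_mul, hξ, mul_one]; exact (Valuation.map_add _ _ _).trans (max_le h00 h11)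
    · exact (Valuation.map_sub _ _ _).trans (max_le ((Valuation.map_add _ _ _).trans
        (max_le (hmul h00 h11) ((Valuation.map_add _ _ _).trans (max_le h00 h11)))) (hmul h01 h10))
  rcases eq_or_ne (ξ - 1) 0 with h0 | h0
  · rw [h0, Valuation.map_zero]; exact zero_le
  have hv0 : Valued.v (ξ - 1) ≠ 0 := (Valuation.ne_zero_iff _).2 h0
  rw [← WithZero.exp_log hv0] at hv2 ⊢
  rw [hϖ, ← WithZero.exp_nsmul, ← WithZero.exp_add, WithZero.exp_le_exp] at hv2
  rw [hϖ, ← WithZero.exp_nsmul, WithZero.exp_le_exp]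
  simp only [nsmul_eq_mul] at hv2 ⊢
  omega

/-- Over a field, multiplying by a non-zero square does not change the square class. [folklore] -/
private theorem isSquare_sq_mul_iff_of_ne_zero {F : Type*} [Field F] {a : F} (ha : a ≠ 0) (t : F) : IsSquare (a ^ 2 * t) ↔ IsSquare t := by
  constructor
  · rintro ⟨r, hr⟩
    refine ⟨r / a, ?_⟩
    field_simp
    linear_combination hr
  · rintro ⟨r, hr⟩
    exact ⟨a * r, by rw [hr]; ring⟩

/-- `quadraticChar` is invariant under isomorphisms of finite fields. [folklore] -/
private theorem quadraticChar_ringEquiv_apply {F F' : Type*} [Field F] [Fintype F] [DecidableEq F] [Field F'] [Fintype F'] [DecidableEq F']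
    (e : F ≃+* F') (a : F) : quadraticChar F' (e a) = quadraticChar F a := by
  by_cases ha : a = 0
  · rw [ha, map_zero, quadraticChar_zero, quadraticChar_zero]
  have ha' : e a ≠ 0 := (map_ne_zero_iff (e : F →+* F') e.injective).2 ha
  by_cases hs : IsSquare a
  · rw [(quadraticChar_one_iff_isSquare ha).2 hs, (quadraticChar_one_iff_isSquare ha').2 (hs.map e)]
  · rw [quadraticChar_neg_one_iff_not_isSquare.2 hs, quadraticChar_neg_one_iff_not_isSquare.2 (fun hs' => hs ?_)]
    simpa using hs'.map e.symm

/-- The `Valued` and the `ValuativeRel` integer rings of a compatibly valued field agree (`Valued.integer K = 𝒪[K]`): a ring isomorphism over `K` and the induced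
isomorphism of residue fields. [folklore] -/
private theorem exists_valuedInteger_ringEquiv (K : Type*) [Field K] [Valued K ℤᵐ⁰] [ValuativeRel K] [(Valued.v : Valuation K ℤᵐ⁰).Compatible] :
    ∃ (e : Valued.integer K ≃+* 𝒪[K]) (eb : IsLocalRing.ResidueField (Valued.integer K) ≃+* 𝓀[K]),
      (∀ z, ((e z : 𝒪[K]) : K) = z) ∧ ∀ z, eb (IsLocalRing.residue (Valued.integer K) z) = IsLocalRing.residue 𝒪[K] (e z) :=
  ⟨RingEquiv.subringCongr valuedInteger_eq_integer, IsLocalRing.ResidueField.mapEquiv (RingEquiv.subringCongr valuedInteger_eq_integer),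
    fun _ => rfl, fun _ => rfl⟩


set_option maxHeartbeats 3200000 in
/-- **(Σ)′ FROM THE JUNCTION (J★): THE κ-SIGNED CLASS SUM OF A `v`-LEVEL-1 PIECE OVER THE FOUR RAMIFIED TYPE-(1) LITERALS** — binders of skeleton v6.2
`stub_typeOne_signedClassSum_ram` VERBATIM (the unused `hμu hμω hg1` `_`-prefixed) + ONE hypothesis `hJ` (the junction head ∀-closed); conclusion VERBATIM:
near `1` (entrywise `ϖ⁴`-deep `γ_H`), `Σ_(b₀b₁) (−1)^(b₁)·Φ(⟦t b₀ b₁⟧, g) = (β, θ)_v · q^m · ν_G(K′) · Σ_j c_j·X̃_j(n)`.  PROOF: ★ (a′) `exists_framed_relabelling_of_literals_ram`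
replaces the quadruple by the framed literals `e(tf_b) = P_b · diag(α, u_w, γ) · P_b⁻¹` (reindexing `b₀` along `π(·, b₁)`); ★ A1‴
`classOrbitalIntegral_eq_mul_latticeStrata_formCongr_of_vDeep_ramified` reads each `Φ(⟦tf_b⟧, g)` as five fixed self-dual lattice counts in the frame `ᵗσ̄_w P_b J₀ P_b =
diag(ε^b₀, ε^b₁, −ε^(b₀+b₁))` (compact centraliser ★ `compactSpace_centralizer_cmDatum_local_of_conj_eq_diagonal`, regularity ★ `isRegularElt_of_isLocalNormPair`, depth by
★ `valBound_coe_conj_sub_one`); `hJ` at `K := L_w`, `σ := σ_w`, `T := diag(α, u_w, γ)`, `(u₀, u₁, u₂) := (1, 1, −1)`, `c₀ := (ι_w y_λ)⁻¹`, exponents `N₁ N₂` of `α − u_w`,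
`u_w − γ` (`N₁ + N₂ = 2m` from the depth token `|χ_g(u)_w| = |ι_w ϖ_v^m|`, `|ι_w ϖ_v| = |ϖ|²`), unit parts `A C`; the sign by ★ (Dict)
`quadraticChar_residue_eq_hilbertSymbol_of_ramified` (transported along `Valued.integer L_w = 𝒪[L_w]`), `q = |𝓀_w| = N(v)` by ★ `natCard_residueField_eq_of_ramified`;
the block (R) `hres hnorm` by ★ `ramifiedBlock_adicCompletion`; final `linear_combination`.
[cite: Rogawski1990, §4.9 Prop. 4.9.1 (a) p. 55, pp. 54–56] [cite: Kottwitz1986, §3] [cite: LabesseLanglands1979, §2 Lemma 2.1] -/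
theorem typeOne_signedClassSum_ram_of_junction
    (L : Type) [Field L] [NumberField L] [IsCMField L] (H' : Matrix (Fin 3) (Fin 3) L) (μ : HeckeCharacter L)
    {v : HeightOneSpectrum (𝓞 ↥(maximalRealSubfield L))}
    (hH' : (H'.map (cmConjRingHom L)).transpose = H') (w : PlacesOver L v)
    (hw : IsCMField.complexConj L • w.1 = w.1) (he : v.asIdeal.ramificationIdx' w.1.asIdeal ≠ 1)
    (hH'w : IsUnit (placeForm H' w.1)) (hH'i : hH'w.unit ∈ glInt 3 (w.1.adicCompletion L))
    (_hμu : μ.IsUnitary)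
    (_hμω : ∀ x : ideleGroup ↥(maximalRealSubfield L), μ (AdeleRing.ideleBaseChange ↥(maximalRealSubfield L) L x) = quadraticHeckeCharCM L x)
    (h2 : IsUnit (2 : 𝒪[w.1.adicCompletion L]))
    -- the ramified block (R) and the integral antidiagonal frame of `H′_w` (★ `ramifiedBlock_adicCompletion`, ★ p846344) — SUPPLIED by the contract, BINDERS for the sockets
    (ϖ : w.1.adicCompletion L) (hϖ : Valued.v ϖ = WithZero.exp (-1 : ℤ)) (hσϖ : galAdicCompletionMap (L := L) (IsCMField.complexConj L) hw ϖ = -ϖ)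
    (A : GL (Fin 3) (w.1.adicCompletion L)) (hA : A ∈ glInt 3 (w.1.adicCompletion L))
    (hframe : placeForm H' w.1 = (-(placeForm H' w.1).det) • formCongr (galAdicCompletionMap (L := L) (IsCMField.complexConj L) hw) A ((StdForm.antidiagonal 3).over (w.1.adicCompletion L)))
    [MeasurableSpace ((cmDatum L 3 H').Local v)] [BorelSpace ((cmDatum L 3 H').Local v)]
    [∀ γ : ((cmDatum L 3 H').Local v), MeasurableSpace (((cmDatum L 3 H').Local v) ⧸ Subgroup.centralizer ({γ} : Set ((cmDatum L 3 H').Local v)))]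
    [∀ γ : ((cmDatum L 3 H').Local v), BorelSpace (((cmDatum L 3 H').Local v) ⧸ Subgroup.centralizer ({γ} : Set ((cmDatum L 3 H').Local v)))]
    (νG : Measure ((cmDatum L 3 H').Local v)) [νG.IsHaarMeasure] [νG.IsMulRightInvariant]
    {mG : OrbitalMeasureFamily ((cmDatum L 3 H').Local v)}
    (hmG : mG.IsCanonical (fun γ => IsRegularElt (γ.val : GL (Fin 3) (UnitaryGroup.LocalRing L v))) νG)
    -- the piece: `C_c^∞`, supported in the hyperspecial `K`, `Ad K`-invariant, left-invariant under the level-2 congruence set (A-69 (β), `j = 2`)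
    (g : ((cmDatum L 3 H').Local v) → ℂ) (hg : IsLocSmooth g) (hgK : tsupport g ⊆ (cmLocalIntegralLevel L 3 H' v : Set ((cmDatum L 3 H').Local v)))
    (hginv : ∀ u ∈ cmLocalIntegralLevel L 3 H' v, ∀ x, g (u * x * u⁻¹) = g x)
    (_hg1 : ∀ u : (cmDatum L 3 H').Local v,
      (∀ a b, Valued.v (((toPlace v w (HeckeCharacter.uniformizer ↥(maximalRealSubfield L) v : v.adicCompletion ↥(maximalRealSubfield L))) ^ 1)⁻¹ *
        ((((localNonsplitEquiv (IsCMField.complexConj L) H' (IsCMField.complexConj_ne_one L) w hw u :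
            ↥(unitaryGroupOfForm (galAdicCompletionMap (L := L) (IsCMField.complexConj L) hw) (placeForm H' w.1))) : GL (Fin 3) (w.1.adicCompletion L)) :
              Matrix (Fin 3) (Fin 3) (w.1.adicCompletion L)) a b - (1 : Matrix (Fin 3) (Fin 3) (w.1.adicCompletion L)) a b)) ≤ 1) →
      ∀ x, g (u * x) = g x)
    -- the two-layer strata values of `g` (★ F0P2-p01 head rows VERBATIM, in the (L)-ram L5-C2 binder shapes)
    (c₂ : ℂ) (c' : ℕ → ℂ) (hc : ∀ x : ((cmDatum L 3 H').Local v), (x ∈ cmLocalIntegralLevel L 3 H' v ∧ (redMat (((x).val : GL (Fin 3) (UnitaryGroup.LocalRing L v)).val.map (Pi.evalRingHom (fun w' : PlacesOver L v => w'.1.adicCompletion L) w)) - 1) ^ 3 = 0 ∧ (redMat (((x).val : GL (Fin 3) (UnitaryGroup.LocalRing L v)).val.map (Pi.evalRingHom (fun w' : PlacesOver L v => w'.1.adicCompletion L) w)) - 1).rank = 2 ∧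
        ∃ y : ((cmDatum L 3 H').Local v), (∀ a b, Valued.v (((toPlace v w (HeckeCharacter.uniformizer ↥(maximalRealSubfield L) v : v.adicCompletion ↥(maximalRealSubfield L))) ^ 1)⁻¹ *
        ((((localNonsplitEquiv (IsCMField.complexConj L) H' (IsCMField.complexConj_ne_one L) w hw (y * x * y⁻¹) :
            ↥(unitaryGroupOfForm (galAdicCompletionMap (L := L) (IsCMField.complexConj L) hw) (placeForm H' w.1))) : GL (Fin 3) (w.1.adicCompletion L)) :
              Matrix (Fin 3) (Fin 3) (w.1.adicCompletion L)) a b - (1 : Matrix (Fin 3) (Fin 3) (w.1.adicCompletion L)) a b)) ≤ 1)) → g x = c₂)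
    (hc' : ((∀ x : ((cmDatum L 3 H').Local v), (x ∈ cmLocalIntegralLevel L 3 H' v ∧ (∀ a b, Valued.v (ϖ⁻¹ * ((((x).val : GL (Fin 3) (UnitaryGroup.LocalRing L v)).val.map (Pi.evalRingHom (fun w' : PlacesOver L v => w'.1.adicCompletion L) w)) a b - (1 : Matrix (Fin 3) (Fin 3) (w.1.adicCompletion L)) a b)) ≤ 1) ∧
        (redMat (ϖ⁻¹ • ((((x).val : GL (Fin 3) (UnitaryGroup.LocalRing L v)).val.map (Pi.evalRingHom (fun w' : PlacesOver L v => w'.1.adicCompletion L) w)) - 1))) ^ 3 = 0 ∧ (redMat (ϖ⁻¹ • ((((x).val : GL (Fin 3) (UnitaryGroup.LocalRing L v)).val.map (Pi.evalRingHom (fun w' : PlacesOver L v => w'.1.adicCompletion L) w)) - 1))).rank = 0) → g x = c' 0) ∧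
      (∀ x : ((cmDatum L 3 H').Local v), (x ∈ cmLocalIntegralLevel L 3 H' v ∧ (∀ a b, Valued.v (ϖ⁻¹ * ((((x).val : GL (Fin 3) (UnitaryGroup.LocalRing L v)).val.map (Pi.evalRingHom (fun w' : PlacesOver L v => w'.1.adicCompletion L) w)) a b - (1 : Matrix (Fin 3) (Fin 3) (w.1.adicCompletion L)) a b)) ≤ 1) ∧
        (redMat (ϖ⁻¹ • ((((x).val : GL (Fin 3) (UnitaryGroup.LocalRing L v)).val.map (Pi.evalRingHom (fun w' : PlacesOver L v => w'.1.adicCompletion L) w)) - 1))) ^ 3 = 0 ∧ (redMat (ϖ⁻¹ • ((((x).val : GL (Fin 3) (UnitaryGroup.LocalRing L v)).val.map (Pi.evalRingHom (fun w' : PlacesOver L v => w'.1.adicCompletion L) w)) - 1))).rank = 2) → g x = c' 2)))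
    (c₁s c₁n : ℂ)
    (hR4s : (∀ (x : ((cmDatum L 3 H').Local v)) (z : Fin 3 → 𝓀[(w.1.adicCompletion L)]), (x ∈ cmLocalIntegralLevel L 3 H' v ∧
        (∀ a b, Valued.v (ϖ⁻¹ * ((((x).val : GL (Fin 3) (UnitaryGroup.LocalRing L v)).val.map (Pi.evalRingHom (fun w' : PlacesOver L v => w'.1.adicCompletion L) w)) a b - (1 : Matrix (Fin 3) (Fin 3) (w.1.adicCompletion L)) a b)) ≤ 1) ∧
        (redMat (ϖ⁻¹ • ((((x).val : GL (Fin 3) (UnitaryGroup.LocalRing L v)).val.map (Pi.evalRingHom (fun w' : PlacesOver L v => w'.1.adicCompletion L) w)) - 1))) ^ 3 = 0 ∧ (redMat (ϖ⁻¹ • ((((x).val : GL (Fin 3) (UnitaryGroup.LocalRing L v)).val.map (Pi.evalRingHom (fun w' : PlacesOver L v => w'.1.adicCompletion L) w)) - 1))).rank = 1 ∧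
        z ⬝ᵥ ((redMat (placeForm H' w.1) * redMat (ϖ⁻¹ • ((((x).val : GL (Fin 3) (UnitaryGroup.LocalRing L v)).val.map (Pi.evalRingHom (fun w' : PlacesOver L v => w'.1.adicCompletion L) w)) - 1))) *ᵥ z) ≠ 0 ∧ IsSquare (z ⬝ᵥ ((redMat (placeForm H' w.1) * redMat (ϖ⁻¹ • ((((x).val : GL (Fin 3) (UnitaryGroup.LocalRing L v)).val.map (Pi.evalRingHom (fun w' : PlacesOver L v => w'.1.adicCompletion L) w)) - 1))) *ᵥ z))) →
        g x = c₁s))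
    (hR4n : (∀ (x : ((cmDatum L 3 H').Local v)) (z : Fin 3 → 𝓀[(w.1.adicCompletion L)]), (x ∈ cmLocalIntegralLevel L 3 H' v ∧
        (∀ a b, Valued.v (ϖ⁻¹ * ((((x).val : GL (Fin 3) (UnitaryGroup.LocalRing L v)).val.map (Pi.evalRingHom (fun w' : PlacesOver L v => w'.1.adicCompletion L) w)) a b - (1 : Matrix (Fin 3) (Fin 3) (w.1.adicCompletion L)) a b)) ≤ 1) ∧
        (redMat (ϖ⁻¹ • ((((x).val : GL (Fin 3) (UnitaryGroup.LocalRing L v)).val.map (Pi.evalRingHom (fun w' : PlacesOver L v => w'.1.adicCompletion L) w)) - 1))) ^ 3 = 0 ∧ (redMat (ϖ⁻¹ • ((((x).val : GL (Fin 3) (UnitaryGroup.LocalRing L v)).val.map (Pi.evalRingHom (fun w' : PlacesOver L v => w'.1.adicCompletion L) w)) - 1))).rank = 1 ∧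
        z ⬝ᵥ ((redMat (placeForm H' w.1) * redMat (ϖ⁻¹ • ((((x).val : GL (Fin 3) (UnitaryGroup.LocalRing L v)).val.map (Pi.evalRingHom (fun w' : PlacesOver L v => w'.1.adicCompletion L) w)) - 1))) *ᵥ z) ≠ 0 ∧ ¬ IsSquare (z ⬝ᵥ ((redMat (placeForm H' w.1) * redMat (ϖ⁻¹ • ((((x).val : GL (Fin 3) (UnitaryGroup.LocalRing L v)).val.map (Pi.evalRingHom (fun w' : PlacesOver L v => w'.1.adicCompletion L) w)) - 1))) *ᵥ z))) →
        g x = c₁n))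
    -- `y_λ ∈ L⁺_v` with `ι_w y_λ = −det H′_w` (the C-Δ Levi value's Hilbert symbol `(y_λ, θ)_v`)
    (yl : v.adicCompletion ↥(maximalRealSubfield L)) (hyl : toPlace v w yl = -(placeForm H' w.1).det)
    -- (J★) THE JUNCTION (F0P3a-p01 (g16) sf v3 04fe0ed23a1e21a7 :42–:87, ∀-closed over its abstract model; `K : Type` so that it instantiates at `K := L_w`;
    -- the `Valued`-scoped notations `𝒪[K]`, `𝓀[K]` of the junction file are spelled `Valued.integer K`, `Valued.ResidueField K` (this file opens `ValuativeRel`'s `𝒪[·]`))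
    (hJ : ∀ {K : Type} [Field K] [Valued K ℤᵐ⁰]
      {σ : K →+* K} {ϖ : K} (hσ : ∀ x, σ (σ x) = x) (hvσ : ∀ a, Valued.v (σ a) = Valued.v a) (hϖ : Valued.v ϖ = WithZero.exp (-1 : ℤ)) (hσϖ : σ ϖ = -ϖ)
      (hres : ∀ x : K, Valued.v x ≤ 1 → Valued.v (σ x - x) < 1) (h2 : Valued.v (2 : K) = 1)
      (hnorm : ∀ u : K, σ u = u → Valued.v (u - 1) < 1 → ∃ z : K, z * σ z = u ∧ Valued.v (z - 1) ≤ Valued.v (u - 1)) [Fintype (Valued.ResidueField K)] [DecidableEq (Valued.ResidueField K)]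
      -- the torus datum: σ-fixed INTEGERS `u₀ u₁ u₂` (units), `ε` (a unit, residually a non-square), `c₀` (a unit, the rank-one class constant)
      (u₀ u₁ u₂ ε c₀ : (Valued.integer K)) (hu₀ : Valued.v (u₀ : K) = 1) (hu₁ : Valued.v (u₁ : K) = 1) (hu₂ : Valued.v (u₂ : K) = 1) (hεv : Valued.v (ε : K) = 1) (hc₀ : Valued.v (c₀ : K) = 1)
      (hσu₀ : σ u₀ = u₀) (hσu₁ : σ u₁ = u₁) (hσu₂ : σ u₂ = u₂) (hσε : σ ε = ε) (hσc₀ : σ c₀ = c₀)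
      (hε : ¬ IsSquare (IsLocalRing.residue (Valued.integer K) ε))
      -- the element: norm-one diagonal entries, `v`-deep (`≡ 1 (ϖ²)`), depths `N₁ = depth(α − u)`, `N₂ = depth(u − γ)` (`N₁ + N₂ = 2m`), `N = depth(α − γ) = 2n+1`, `n ≥ 1`,
      -- with the LEADING COEFFICIENTS `A = (α − u)∕ϖ^{N₁}`, `C = (γ − u)∕ϖ^{N₂}` (integers, units by `hN₁`, `hN₂`) that enter the sign
      (α u γ : K) (hα : α * σ α = 1) (hu : u * σ u = 1) (hγ : γ * σ γ = 1)
      (hα2 : Valued.v (α - 1) ≤ Valued.v ϖ ^ 2) (hu2 : Valued.v (u - 1) ≤ Valued.v ϖ ^ 2) (hγ2 : Valued.v (γ - 1) ≤ Valued.v ϖ ^ 2)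
      (T : GL (Fin 3) K) (hT : (T : Matrix (Fin 3) (Fin 3) K) = Matrix.diagonal ![α, u, γ])
      (N₁ N₂ N m n : ℕ) (hN₁ : Valued.v (α - u) = Valued.v ϖ ^ N₁) (hN₂ : Valued.v (u - γ) = Valued.v ϖ ^ N₂) (hN : Valued.v (α - γ) = Valued.v ϖ ^ N)
      (hm : N₁ + N₂ = 2 * m) (hn : N = 2 * n + 1) (h1n : 1 ≤ n)
      (A C : (Valued.integer K)) (hA : α - u = (A : K) * ϖ ^ N₁) (hC : γ - u = (C : K) * ϖ ^ N₂),
      ∀ j : Fin 5,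
        ∑ b : Fin 2 × Fin 2, (-1 : ℚ) ^ (b.2 : ℕ) *
          (({M : Submodule (Valued.integer K) (Fin 3 → K) |
              IsSelfDualLattice σ ϖ (Matrix.diagonal ![((ε : K)) ^ (b.1 : ℕ) * (u₀ : K), (ε : K) ^ (b.2 : ℕ) * (u₁ : K), (ε : K) ^ ((b.1 : ℕ) + (b.2 : ℕ)) * (u₂ : K)]) M ∧ mapGL T M = M ∧
                (![-- bd : `¬ (T − 1)M ⊆ ϖM`
                    ¬ M.map ((Matrix.toLin' ((T : Matrix (Fin 3) (Fin 3) K) - 1)).restrictScalars (Valued.integer K)) ≤ scaleLattice ϖ M,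
                  -- reg : depth 1, rank 2
                    M.map ((Matrix.toLin' ((T : Matrix (Fin 3) (Fin 3) K) - 1)).restrictScalars (Valued.integer K)) ≤ scaleLattice ϖ M ∧
                      ¬ M.map ((Matrix.toLin' ((T : Matrix (Fin 3) (Fin 3) K) - 1)).restrictScalars (Valued.integer K)) ≤ scaleLattice (ϖ ^ 2) M ∧
                      ¬ M.map ((Matrix.toLin' (((T : Matrix (Fin 3) (Fin 3) K) - 1) ^ 2)).restrictScalars (Valued.integer K)) ≤ scaleLattice (ϖ ^ 3) M,
                  -- 1s : depth 1, rank 1, class `c₀`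
                    M.map ((Matrix.toLin' ((T : Matrix (Fin 3) (Fin 3) K) - 1)).restrictScalars (Valued.integer K)) ≤ scaleLattice ϖ M ∧
                      ¬ M.map ((Matrix.toLin' ((T : Matrix (Fin 3) (Fin 3) K) - 1)).restrictScalars (Valued.integer K)) ≤ scaleLattice (ϖ ^ 2) M ∧
                      M.map ((Matrix.toLin' (((T : Matrix (Fin 3) (Fin 3) K) - 1) ^ 2)).restrictScalars (Valued.integer K)) ≤ scaleLattice (ϖ ^ 3) M ∧
                      ∃ y ∈ M, ∃ a : K, Valued.v a = 1 ∧
                        Valued.v (ϖ⁻¹ * pairing σ (Matrix.diagonal ![((ε : K)) ^ (b.1 : ℕ) * (u₀ : K), (ε : K) ^ (b.2 : ℕ) * (u₁ : K), (ε : K) ^ ((b.1 : ℕ) + (b.2 : ℕ)) * (u₂ : K)]) y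
                          (((T : Matrix (Fin 3) (Fin 3) K) - 1) *ᵥ y) - (c₀ : K) * a ^ 2) < 1,
                  -- 1n : depth 1, rank 1, class `c₀·ε`
                    M.map ((Matrix.toLin' ((T : Matrix (Fin 3) (Fin 3) K) - 1)).restrictScalars (Valued.integer K)) ≤ scaleLattice ϖ M ∧
                      ¬ M.map ((Matrix.toLin' ((T : Matrix (Fin 3) (Fin 3) K) - 1)).restrictScalars (Valued.integer K)) ≤ scaleLattice (ϖ ^ 2) M ∧
                      M.map ((Matrix.toLin' (((T : Matrix (Fin 3) (Fin 3) K) - 1) ^ 2)).restrictScalars (Valued.integer K)) ≤ scaleLattice (ϖ ^ 3) M ∧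
                      ∃ y ∈ M, ∃ a : K, Valued.v a = 1 ∧
                        Valued.v (ϖ⁻¹ * pairing σ (Matrix.diagonal ![((ε : K)) ^ (b.1 : ℕ) * (u₀ : K), (ε : K) ^ (b.2 : ℕ) * (u₁ : K), (ε : K) ^ ((b.1 : ℕ) + (b.2 : ℕ)) * (u₂ : K)]) y
                          (((T : Matrix (Fin 3) (Fin 3) K) - 1) *ᵥ y) - (c₀ : K) * (ε : K) * a ^ 2) < 1,
                  -- 0 : depth ≥ 2
                    M.map ((Matrix.toLin' ((T : Matrix (Fin 3) (Fin 3) K) - 1)).restrictScalars (Valued.integer K)) ≤ scaleLattice (ϖ ^ 2) M] : Fin 5 → Prop) j}.ncard : ℕ) : ℚ) =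
          ((quadraticChar (Valued.ResidueField K) (IsLocalRing.residue (Valued.integer K) ((-1) ^ m * (u₀ * u₂ * A * C))) : ℤ) : ℚ) * (Fintype.card (Valued.ResidueField K) : ℚ) ^ m *
            (![4 * (Fintype.card (Valued.ResidueField K) : ℚ) ^ n, 4 * (Fintype.card (Valued.ResidueField K) : ℚ) ^ (n - 1), (2 * ((Fintype.card (Valued.ResidueField K) : ℚ) ^ n - Fintype.card (Valued.ResidueField K) - 1)) / (Fintype.card (Valued.ResidueField K) : ℚ) ^ 2,
                (2 * ((Fintype.card (Valued.ResidueField K) : ℚ) ^ n - Fintype.card (Valued.ResidueField K) - 1)) / (Fintype.card (Valued.ResidueField K) : ℚ) ^ 2,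
                (4 * ((Fintype.card (Valued.ResidueField K) : ℚ) ^ n - 1)) / (((Fintype.card (Valued.ResidueField K) : ℚ) - 1) * (Fintype.card (Valued.ResidueField K) : ℚ) ^ 2)] : Fin 5 → ℚ) j) :
    ∃ V ∈ 𝓝 (1 : ((cmDatum L 2 (Matrix.of fun i j : Fin 2 => if i.val + j.val + 1 = 2 then (1 : L) else 0)).Local v × (cmDatum L 1 (Matrix.of fun i j : Fin 1 => if i.val + j.val + 1 = 1 then (1 : L) else 0)).Local v)),
      ∀ γH ∈ V, IsLocalGRegular L v γH →
        (∃ x : (w.1.adicCompletion L), (((γH.1.val : GL (Fin 2) (UnitaryGroup.LocalRing L v)).val.map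
          (Pi.evalRingHom (fun w' : PlacesOver L v => w'.1.adicCompletion L) w)).charpoly).IsRoot x) →
        ¬ (∃ (y : ((cmDatum L 2 (Matrix.of fun i j : Fin 2 => if i.val + j.val + 1 = 2 then (1 : L) else 0)).Local v × (cmDatum L 1 (Matrix.of fun i j : Fin 1 => if i.val + j.val + 1 = 1 then (1 : L) else 0)).Local v)) (d' : Fin 2 → (UnitaryGroup.LocalRing L v)ˣ),
          glDiagonal 2 (UnitaryGroup.LocalRing L v) d' = ((y * γH * y⁻¹).1.val : GL (Fin 2) (UnitaryGroup.LocalRing L v))) →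
        ∀ (α γ : (w.1.adicCompletion L)),
          ((((γH.1.val : GL (Fin 2) (UnitaryGroup.LocalRing L v)) : Matrix (Fin 2) (Fin 2) (UnitaryGroup.LocalRing L v)).charpoly).map (Pi.evalRingHom (fun w' : PlacesOver L v => w'.1.adicCompletion L) w)).IsRoot α →
          ((((γH.1.val : GL (Fin 2) (UnitaryGroup.LocalRing L v)) : Matrix (Fin 2) (Fin 2) (UnitaryGroup.LocalRing L v)).charpoly).map (Pi.evalRingHom (fun w' : PlacesOver L v => w'.1.adicCompletion L) w)).IsRoot γ →
          α ≠ γ → ∀ N : ℕ, Valued.v (α - γ) = WithZero.exp (-(N : ℤ)) →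
          ∀ n : ℕ, N = 2 * n + 1 → 1 ≤ n →
          ∀ m : ℕ, Valued.v (((finCharpolyTwo L v γH).eval (finGammaTwo L v γH)) w) = Valued.v ((toPlace v w (HeckeCharacter.uniformizer ↥(maximalRealSubfield L) v : v.adicCompletion ↥(maximalRealSubfield L))) ^ m) →
          ∀ β : (v.adicCompletion ↥(maximalRealSubfield L))ˣ, toPlace v w (β : v.adicCompletion ↥(maximalRealSubfield L)) =
            -(((finCharpolyTwo L v γH).eval (finGammaTwo L v γH)) w *
                (finGammaTwo L v γH w ^ 2 +
                  ((γH.1.val.val : Matrix (Fin 2) (Fin 2) (UnitaryGroup.LocalRing L v)).map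
                    (Pi.evalRingHom (fun w' : UnitaryGroup.PlacesOver L v => w'.1.adicCompletion L) w)).det)) /
              (2 * finGammaTwo L v γH w ^ 2 *
                ((γH.1.val.val : Matrix (Fin 2) (Fin 2) (UnitaryGroup.LocalRing L v)).map
                    (Pi.evalRingHom (fun w' : UnitaryGroup.PlacesOver L v => w'.1.adicCompletion L) w)).det) →
          ∀ {t : Fin 2 → Fin 2 → ((cmDatum L 3 H').Local v)}, (∀ b₀ b₁, IsLocalNormPair L H' v γH (t b₀ b₁)) → (∀ b₀ b₁ b₀' b₁', IsConj (t b₀ b₁) (t b₀' b₁') → b₀ = b₀' ∧ b₁ = b₁') →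
          ∀ {Q : GL (Fin 3) (w.1.adicCompletion L)} {x : Fin 3 → (w.1.adicCompletion L)}, ((((localNonsplitEquiv (IsCMField.complexConj L) H' (IsCMField.complexConj_ne_one L) w hw (t 0 0)).val :
              GL (Fin 3) (w.1.adicCompletion L)) : Matrix (Fin 3) (Fin 3) (w.1.adicCompletion L)) * Q.val = Q.val * diagonal x) → Function.Injective x → (∀ i, galAdicCompletionMap (L := L) (IsCMField.complexConj L) hw (x i) * x i = 1) →
          ∀ {s : ℤ}, (s = 1 ∨ s = -1) → (∀ b₀ b₁, finKappaAt L v H' γH (t b₀ b₁) = s * (-1) ^ (b₁ : ℕ)) → (s : ℂ) = (hilbertSymbol (v.adicCompletion ↥(maximalRealSubfield L)) yl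
        (algebraMap ↥(maximalRealSubfield L) _ ((cmQuadraticGenerator L : 𝓞 ↥(maximalRealSubfield L)) : ↥(maximalRealSubfield L))) : ℂ) →
          ∑ b₀ : Fin 2, ∑ b₁ : Fin 2, (-1 : ℂ) ^ (b₁ : ℕ) * classOrbitalIntegral mG g (ConjClasses.mk (t b₀ b₁)) =
            (hilbertSymbol (v.adicCompletion ↥(maximalRealSubfield L)) (β : v.adicCompletion ↥(maximalRealSubfield L))
                (algebraMap ↥(maximalRealSubfield L) _ ((cmQuadraticGenerator L : 𝓞 ↥(maximalRealSubfield L)) : ↥(maximalRealSubfield L))) : ℂ) * (Ideal.absNorm v.asIdeal : ℂ) ^ m * ((νG.real (cmLocalIntegralLevel L 3 H' v : Set ((cmDatum L 3 H').Local v)) : ℝ) : ℂ) * (c₂ * (4 * (Ideal.absNorm v.asIdeal : ℂ) ^ n) + c' 2 * (4 * (Ideal.absNorm v.asIdeal : ℂ) ^ (n - 1)) + c₁s * (2 * ((Ideal.absNorm v.asIdeal : ℂ) ^ n - (Ideal.absNorm v.asIdeal : ℂ) - 1) / (Ideal.absNorm v.asIdeal : ℂ) ^ 2) +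
              c₁n * (2 * ((Ideal.absNorm v.asIdeal : ℂ) ^ n - (Ideal.absNorm v.asIdeal : ℂ) - 1) / (Ideal.absNorm v.asIdeal : ℂ) ^ 2) + c' 0 * (4 * ((Ideal.absNorm v.asIdeal : ℂ) ^ n - 1) / (((Ideal.absNorm v.asIdeal : ℂ) - 1) * (Ideal.absNorm v.asIdeal : ℂ) ^ 2))) := by
  classical
  have hc1 : IsCMField.complexConj L ≠ 1 := IsCMField.complexConj_ne_one L
  have h2v : Valued.v (2 : (w.1.adicCompletion L)) = 1 := (isUnit_two_integer_iff_valued_eq_one L w.1).1 h2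
  have hσσ : ∀ z : (w.1.adicCompletion L), (galAdicCompletionMap (L := L) (IsCMField.complexConj L) hw) ((galAdicCompletionMap (L := L) (IsCMField.complexConj L) hw) z) = z :=
    galAdicCompletionMap_galAdicCompletionMap_of_smul_eq (IsCMField.complexConj L) w hc1 hw
  have hvσ : ∀ z : (w.1.adicCompletion L), Valued.v ((galAdicCompletionMap (L := L) (IsCMField.complexConj L) hw) z) = Valued.v z := fun z =>
    valued_galAdicCompletionMap (L := L) (IsCMField.complexConj L) hw z
  obtain ⟨-, -, -, hres, hnorm⟩ := ramifiedBlock_adicCompletion L v w hw he h2v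
  have hϖ0 : ϖ ≠ 0 := fun h0 => by rw [h0, Valuation.map_zero] at hϖ; exact WithZero.exp_ne_zero hϖ.symm
  have hvϖ0 : Valued.v ϖ ≠ 0 := (Valuation.ne_zero_iff _).2 hϖ0
  have hϖlt : Valued.v ϖ < 1 := by rw [hϖ, ← WithZero.exp_zero]; exact WithZero.exp_lt_exp.2 (by norm_num)
  have hιϖ : Valued.v (toPlace v w (HeckeCharacter.uniformizer ↥(maximalRealSubfield L) v : v.adicCompletion ↥(maximalRealSubfield L))) = Valued.v ϖ ^ 2 := by
    rw [valued_toPlace_eq_pow_two_of_ramified (IsCMField.complexConj L) w hc1 hw he, HeckeCharacter.valued_uniformizer, hϖ]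
  have hι0 : Valued.v (toPlace v w (HeckeCharacter.uniformizer ↥(maximalRealSubfield L) v : v.adicCompletion ↥(maximalRealSubfield L))) ≠ 0 := by rw [hιϖ]; exact pow_ne_zero _ hvϖ0
  -- THE NEIGHBOURHOOD: `g_w ≡ 1` entrywise and `u_w ≡ 1` modulo `ϖ⁴` (so that the eigen-data are `ϖ²`-deep)
  refine ⟨_, setOf_entrywise_deep_mem_nhds_one L v w (c := ϖ ^ 4) (pow_ne_zero 4 hϖ0), ?_⟩
  intro γH hγV hreg hsplit hlev α γ hα hγ hαγ N hN n hn h1n m hm β hβ t hmatch hinj Q x hQ hx hx1 s hs hκ hsyl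
  obtain ⟨hgdeep, hudeep⟩ := hγV
  rw [Valuation.map_pow] at hudeep
  -- (a′): THE FRAMED QUADRUPLE `tf` AND THE RELABELLING `π`
  have hred := exists_framed_relabelling_of_literals_ram L H' hH' w hw he hH'w h2 A hA hframe yl hyl γH hreg hlev hα hγ hαγ hmatch hinj hs hκ hsyl
  obtain ⟨ε, e, P, tf, π, hσε, hεv, hεN, hfe, hK, hmt, hxinj, hx1', htf, hκf, hπ, hconj⟩ := hred
  -- reindexing the signed sum along `π(·, b₁)`
  have hreidx : (∑ b₀ : Fin 2, ∑ b₁ : Fin 2, (-1 : ℂ) ^ (b₁ : ℕ) * classOrbitalIntegral mG g (ConjClasses.mk (t b₀ b₁))) =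
      ∑ b₀ : Fin 2, ∑ b₁ : Fin 2, (-1 : ℂ) ^ (b₁ : ℕ) * classOrbitalIntegral mG g (ConjClasses.mk (tf b₀ b₁)) := by
    rw [Finset.sum_comm]
    conv_rhs => rw [Finset.sum_comm]
    refine Finset.sum_congr rfl fun b₁ _ => ?_
    have hcl : ∀ b₀, ConjClasses.mk (t (π b₀ b₁) b₁) = ConjClasses.mk (tf b₀ b₁) := fun b₀ =>
      ConjClasses.mk_eq_mk_iff_isConj.2 (hconj b₀ b₁)
    rw [← Equiv.sum_comp (Equiv.ofBijective _ (hπ b₁)) (fun b₀ => (-1 : ℂ) ^ (b₁ : ℕ) * classOrbitalIntegral mG g (ConjClasses.mk (t b₀ b₁)))]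
    refine Finset.sum_congr rfl fun b₀ _ => ?_
    rw [Equiv.ofBijective_apply, hcl]
  rw [hreidx]
  -- THE SEMILOCAL EIGENFRAME OF `g = γ_H.1`: `χ_(g,w)(u_w) = (u_w − α)(u_w − γ)`, `det g_w = αγ`
  have hsep := (isRegularElt_fst_snd_of_isLocalGRegular L v γH hreg).1
  have hef := exists_eigenframe_cmDatum_local_of_isRoot_map_of_separable L v w hw γH.1 hα hsep
  obtain ⟨P₂, u, hP₂, hu, hu0⟩ := hef
  have hu1w : u 1 w = γ := by
    rcases eq_or_eq_eval_of_isRoot_of_eigenframe L v w (γ := (γH.1.val : GL (Fin 2) (UnitaryGroup.LocalRing L v))) hP₂ hγ with h | h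
    · exact absurd (hu0.symm.trans h.symm) hαγ
    · exact h.symm
  have hconj2 : (P₂⁻¹).val * (γH.1.val.val : Matrix (Fin 2) (Fin 2) (UnitaryGroup.LocalRing L v)) * P₂.val = diagonal u := by
    rw [Matrix.mul_assoc, hP₂, ← Matrix.mul_assoc, Units.inv_mul, Matrix.one_mul]
  have hchar : finCharpolyTwo L v γH = (X - C (u 0)) * (X - C (u 1)) := by
    show (γH.1.val.val : Matrix (Fin 2) (Fin 2) (UnitaryGroup.LocalRing L v)).charpoly = _
    rw [← Matrix.charpoly_units_conj' P₂, ← Matrix.coe_units_inv, hconj2, Matrix.charpoly_diagonal, Fin.prod_univ_two]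
  have hχw : ((finCharpolyTwo L v γH).eval (finGammaTwo L v γH)) w = ((finGammaTwo L v γH w) - α) * ((finGammaTwo L v γH w) - γ) := by
    rw [hchar, eval_mul, eval_sub, eval_sub, eval_X, eval_C, eval_C, Pi.mul_apply, Pi.sub_apply, Pi.sub_apply, hu0, hu1w]
  have hdetw : ((γH.1.val.val : Matrix (Fin 2) (Fin 2) (UnitaryGroup.LocalRing L v)).map
      (Pi.evalRingHom (fun w' : UnitaryGroup.PlacesOver L v => w'.1.adicCompletion L) w)).det = α * γ := by
    have hd : (γH.1.val.val : Matrix (Fin 2) (Fin 2) (UnitaryGroup.LocalRing L v)).det = u 0 * u 1 := by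
      rw [← Matrix.det_units_conj' P₂, hconj2, Matrix.det_diagonal, Fin.prod_univ_two]
    rw [← RingHom.mapMatrix_apply, ← RingHom.map_det, hd, map_mul, Pi.evalRingHom_apply, Pi.evalRingHom_apply, hu0, hu1w]
  -- THE SPECTRUM `(α, u_w, γ)`: units, pairwise distinct, `ϖ²`-deep
  have hxv : ∀ i, Valued.v ((![α, finGammaTwo L v γH w, γ] : Fin 3 → (w.1.adicCompletion L)) i) = 1 := fun i =>
    (v_eq_one_iff_valuation_eq_one _).2 (valuation_eq_one_of_galAdicCompletionMap_mul_self_eq_one L w hw (hx1' i))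
  have hαv : Valued.v α = 1 := hxv 0
  have huv : Valued.v (finGammaTwo L v γH w) = 1 := hxv 1
  have hγv : Valued.v γ = 1 := hxv 2
  have h01 : α ≠ (finGammaTwo L v γH w) := fun h => hxinj.ne (show (0 : Fin 3) ≠ 1 by decide) (by simp [h])
  have h12 : (finGammaTwo L v γH w) ≠ γ := fun h => hxinj.ne (show (1 : Fin 3) ≠ 2 by decide) (by simp [h])
  have hϖ2lt : Valued.v ϖ ^ 2 < 1 := pow_lt_one₀ zero_le hϖlt two_ne_zero
  have hu2 : Valued.v ((finGammaTwo L v γH w) - 1) ≤ Valued.v ϖ ^ 2 := hudeep.trans (pow_le_pow_right_of_le_one' hϖlt.le (by norm_num))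
  have hα2 : Valued.v (α - 1) ≤ Valued.v ϖ ^ 2 :=
    v_sub_one_le_of_isRoot_charpoly_two hϖ _ hgdeep hαv (by rw [Matrix.charpoly_map]; exact hα)
  have hγ2 : Valued.v (γ - 1) ≤ Valued.v ϖ ^ 2 :=
    v_sub_one_le_of_isRoot_charpoly_two hϖ _ hgdeep hγv (by rw [Matrix.charpoly_map]; exact hγ)
  have hα1 : Valued.v (α - 1) < 1 := hα2.trans_lt hϖ2lt
  have hu1 : Valued.v ((finGammaTwo L v γH w) - 1) < 1 := hu2.trans_lt hϖ2lt
  have hγ1 : Valued.v (γ - 1) < 1 := hγ2.trans_lt hϖ2lt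
  -- THE EXPONENTS `N₁ N₂` AND `N₁ + N₂ = 2m`, `|α − γ| = |ϖ|^N`
  have hle1 : ∀ {a b : (w.1.adicCompletion L)}, Valued.v a = 1 → Valued.v b = 1 → Valued.v (a - b) ≤ 1 := fun ha hb =>
    (Valuation.map_sub _ _ _).trans (max_le ha.le hb.le)
  obtain ⟨N₁, hN₁⟩ := exists_nat_v_eq_v_pow hϖ (sub_ne_zero.2 h01) (hle1 hαv huv)
  obtain ⟨N₂, hN₂⟩ := exists_nat_v_eq_v_pow hϖ (sub_ne_zero.2 h12) (hle1 huv hγv)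
  have hN' : Valued.v (α - γ) = Valued.v ϖ ^ N := by
    rw [hN, hϖ, ← WithZero.exp_nsmul, smul_neg, nsmul_eq_mul, mul_one]
  have hmN : N₁ + N₂ = 2 * m := by
    have h1 : Valued.v (((finCharpolyTwo L v γH).eval (finGammaTwo L v γH)) w) = Valued.v ϖ ^ (N₁ + N₂) := by
      rw [hχw, Valuation.map_mul, Valuation.map_sub_swap, hN₁, hN₂, pow_add]
    have h3 : Valued.v ϖ ^ (N₁ + N₂) = Valued.v ϖ ^ (2 * m) := by rw [← h1, hm, Valuation.map_pow, hιϖ, ← pow_mul]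
    rw [hϖ, ← WithZero.exp_nsmul, ← WithZero.exp_nsmul, WithZero.exp_inj] at h3
    simp only [nsmul_eq_mul, mul_neg, mul_one, neg_inj, Nat.cast_inj] at h3
    exact h3
  -- THE UNIT PARTS `A C` (as `Valued` integers)
  have hAint : Valued.v ((α - (finGammaTwo L v γH w)) / ϖ ^ N₁) ≤ 1 := by
    rw [Valuation.map_div, hN₁, Valuation.map_pow, div_self (pow_ne_zero _ hvϖ0)]
  have hCint : Valued.v ((γ - (finGammaTwo L v γH w)) / ϖ ^ N₂) ≤ 1 := by
    rw [Valuation.map_div, Valuation.map_sub_swap, hN₂, Valuation.map_pow, div_self (pow_ne_zero _ hvϖ0)]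
  obtain ⟨AO, hAO⟩ : ∃ AO : Valued.integer (w.1.adicCompletion L), (AO : (w.1.adicCompletion L)) = (α - (finGammaTwo L v γH w)) / ϖ ^ N₁ := ⟨⟨_, hAint⟩, rfl⟩
  obtain ⟨CO, hCO⟩ : ∃ CO : Valued.integer (w.1.adicCompletion L), (CO : (w.1.adicCompletion L)) = (γ - (finGammaTwo L v γH w)) / ϖ ^ N₂ := ⟨⟨_, hCint⟩, rfl⟩
  have hA' : α - (finGammaTwo L v γH w) = (AO : (w.1.adicCompletion L)) * ϖ ^ N₁ := by rw [hAO, div_mul_cancel₀ _ (pow_ne_zero _ hϖ0)]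
  have hC' : γ - (finGammaTwo L v γH w) = (CO : (w.1.adicCompletion L)) * ϖ ^ N₂ := by rw [hCO, div_mul_cancel₀ _ (pow_ne_zero _ hϖ0)]
  -- `ε` AND THE CLASS CONSTANT `d = (ι y_λ)⁻¹ = (−det H′_w)⁻¹` (as `Valued` integers), their residues
  obtain ⟨εO, hεO⟩ : ∃ εO : Valued.integer (w.1.adicCompletion L), (εO : (w.1.adicCompletion L)) = ε := ⟨⟨ε, hεv.le⟩, rfl⟩
  have hεVR : ε ∈ 𝒪[(w.1.adicCompletion L)] := (v_le_one_iff_mem_integer ε).1 hεv.le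
  have hεsqVR : ¬ IsSquare (IsLocalRing.residue 𝒪[(w.1.adicCompletion L)] ⟨ε, hεVR⟩) := fun hsq =>
    hεN (((isSquare_residue_iff_exists_norm_of_fixed_of_ramified L w hw he h2v ⟨ε, hεVR⟩ hεv hσε).1 hsq).imp fun y hy => by
      rw [mul_comm]; exact hy)
  have hεsq : ¬ IsSquare (red ε) := by rw [show red ε = _ from red_coe ⟨ε, hεVR⟩]; exact hεsqVR
  have hdetH : Valued.v (placeForm H' w.1).det = 1 := by
    have h := valuation_det_eq_one_of_mem_glInt hH'i
    rw [IsUnit.unit_spec] at h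
    exact (v_eq_one_iff_valuation_eq_one _).2 h
  have hdet0 : (placeForm H' w.1).det ≠ 0 := fun h0 => by rw [h0, Valuation.map_zero] at hdetH; exact zero_ne_one hdetH
  have hdv : Valued.v (toPlace v w yl)⁻¹ = 1 := by rw [Valuation.map_inv, hyl, Valuation.map_neg, hdetH, inv_one]
  obtain ⟨dO, hdO⟩ : ∃ dO : Valued.integer (w.1.adicCompletion L), (dO : (w.1.adicCompletion L)) = (toPlace v w yl)⁻¹ := ⟨⟨_, hdv.le⟩, rfl⟩
  have hσd : (galAdicCompletionMap (L := L) (IsCMField.complexConj L) hw) (dO : (w.1.adicCompletion L)) = dO := by rw [hdO, map_inv₀, galAdicCompletionMap_toPlace]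
  have hdd : red (dO : (w.1.adicCompletion L)) * red (-(placeForm H' w.1).det) = 1 := by
    rw [← red_mul ((v_le_one_iff_mem_integer _).1 (by rw [hdO]; exact hdv.le)) ((v_le_one_iff_mem_integer _).1 (by rw [Valuation.map_neg, hdetH])),
      hdO, ← hyl, inv_mul_cancel₀ (by rw [hyl]; exact neg_ne_zero.2 hdet0), red_one]
  -- THE TORUS ELEMENT `T = diag(α, u_w, γ)` AND THE LITERALS `e(tf_b) = P_b T P_b⁻¹`
  obtain ⟨T, hTdef⟩ : ∃ T : GL (Fin 3) (w.1.adicCompletion L), T = (P 0 0)⁻¹ * ((e (tf 0 0)).val : GL (Fin 3) (w.1.adicCompletion L)) * P 0 0 := ⟨_, rfl⟩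
  have hT : (T : Matrix (Fin 3) (Fin 3) (w.1.adicCompletion L)) = Matrix.diagonal ![α, finGammaTwo L v γH w, γ] := by
    rw [hTdef, Units.val_mul, Units.val_mul, (htf 0 0).2.2.1, ← Matrix.mul_assoc, ← Matrix.mul_assoc, Units.inv_mul, Matrix.one_mul, Matrix.mul_assoc,
      Units.inv_mul, Matrix.mul_one]
  have heT : ∀ b₀ b₁, ((e (tf b₀ b₁)).val : GL (Fin 3) (w.1.adicCompletion L)) = P b₀ b₁ * T * (P b₀ b₁)⁻¹ := fun b₀ b₁ => by
    apply Units.ext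
    rw [Units.val_mul, Units.val_mul, hT, (htf b₀ b₁).2.2.1]
  have hformb : ∀ b₀ b₁, formCongr (galAdicCompletionMap (L := L) (IsCMField.complexConj L) hw) (P b₀ b₁) (placeForm (Matrix.of fun i j : Fin 3 => if i.val + j.val + 1 = 3 then (1 : L) else 0) w.1) = diagonal ![ε ^ (b₀ : ℕ), ε ^ (b₁ : ℕ), -(ε ^ ((b₀ : ℕ) + (b₁ : ℕ)))] := fun b₀ b₁ => by
    rw [placeForm_antidiagOne]; exact (htf b₀ b₁).2.1
  -- the one-place frame of `tf_b`, compact centraliser, regularity, depth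
  have hQf : ∀ b₀ b₁, (((localNonsplitEquiv (IsCMField.complexConj L) H' (IsCMField.complexConj_ne_one L) w hw (tf b₀ b₁)).val : GL (Fin 3) (w.1.adicCompletion L)) : Matrix (Fin 3) (Fin 3) (w.1.adicCompletion L)) * (A⁻¹ * P b₀ b₁).val = (A⁻¹ * P b₀ b₁).val * diagonal ![α, finGammaTwo L v γH w, γ] :=
    fun b₀ b₁ => onePlace_frame_of_conj_frame (hfe (tf b₀ b₁)) (htf b₀ b₁).2.2.2.1
  have hcpt : ∀ b₀ b₁, CompactSpace ↥(Subgroup.centralizer ({tf b₀ b₁} : Set ((cmDatum L 3 H').Local v))) := fun b₀ b₁ =>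
    compactSpace_centralizer_cmDatum_local_of_conj_eq_diagonal L 3 H' w hw hH'w (tf b₀ b₁) (Matrix.isUnits_det_units (A⁻¹ * P b₀ b₁)) hxinj hx1' (by
      rw [Matrix.mul_assoc, hQf b₀ b₁, ← Matrix.mul_assoc, Matrix.nonsing_inv_mul _ (Matrix.isUnits_det_units _), Matrix.one_mul])
  have hregf : ∀ b₀ b₁, IsRegularElt ((tf b₀ b₁).val : GL (Fin 3) (UnitaryGroup.LocalRing L v)) := fun b₀ b₁ =>
    isRegularElt_of_isLocalNormPair (L := L) (H' := H') (v := v) (htf b₀ b₁).2.2.2.2.2.2.1 hreg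
  have hEeq : ∀ b₀ b₁, ((localNonsplitEquiv (IsCMField.complexConj L) H' (IsCMField.complexConj_ne_one L) w hw (tf b₀ b₁)).val : GL (Fin 3) (w.1.adicCompletion L)) = (A⁻¹ * P b₀ b₁) * T * (A⁻¹ * P b₀ b₁)⁻¹ := fun b₀ b₁ => by
    have h := hfe (tf b₀ b₁)
    rw [heT] at h
    have h' : ((localNonsplitEquiv (IsCMField.complexConj L) H' (IsCMField.complexConj_ne_one L) w hw (tf b₀ b₁)).val : GL (Fin 3) (w.1.adicCompletion L)) = A⁻¹ * (P b₀ b₁ * T * (P b₀ b₁)⁻¹) * A := by rw [h]; group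
    rw [h']; group
  have hVB : ValBound (valuation (w.1.adicCompletion L) (toPlace v w (HeckeCharacter.uniformizer ↥(maximalRealSubfield L) v : v.adicCompletion ↥(maximalRealSubfield L)))) ((T : Matrix (Fin 3) (Fin 3) (w.1.adicCompletion L)) - 1) := by
    intro i j
    rw [← v_le_iff_valuation_le, hιϖ, hT, Matrix.sub_apply, Matrix.diagonal_apply, Matrix.one_apply]
    by_cases hij : i = j
    · subst hij
      rw [if_pos rfl, if_pos rfl]
      fin_cases i
      · exact hα2
      · exact hu2
      · exact hγ2
    · rw [if_neg hij, if_neg hij, sub_zero, Valuation.map_zero]; exact zero_le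
  have hdeepf : ∀ b₀ b₁, ∀ a b, Valued.v (((toPlace v w (HeckeCharacter.uniformizer ↥(maximalRealSubfield L) v : v.adicCompletion ↥(maximalRealSubfield L))) ^ 1)⁻¹ * ((((tf b₀ b₁).val : GL (Fin 3) (UnitaryGroup.LocalRing L v)).val.map
      (Pi.evalRingHom (fun w' : PlacesOver L v => w'.1.adicCompletion L) w)) a b - (1 : Matrix (Fin 3) (Fin 3) (w.1.adicCompletion L)) a b)) ≤ 1 := by
    intro b₀ b₁ a b
    have hκ : A⁻¹ * P b₀ b₁ ∈ glInt 3 (w.1.adicCompletion L) := Subgroup.mul_mem _ (Subgroup.inv_mem _ hA) (htf b₀ b₁).1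
    have hVB' := valBound_coe_conj_sub_one hκ hVB a b
    rw [← hEeq b₀ b₁] at hVB'
    rw [← coe_localNonsplitEquiv_apply L H' v w hw (tf b₀ b₁), ← Matrix.sub_apply, pow_one, Valuation.map_mul, Valuation.map_inv]
    have hy : Valued.v (((((localNonsplitEquiv (IsCMField.complexConj L) H' (IsCMField.complexConj_ne_one L) w hw (tf b₀ b₁)).val : GL (Fin 3) (w.1.adicCompletion L)) :
        Matrix (Fin 3) (Fin 3) (w.1.adicCompletion L)) - 1) a b) ≤ Valued.v (toPlace v w (HeckeCharacter.uniformizer ↥(maximalRealSubfield L) v : v.adicCompletion ↥(maximalRealSubfield L))) := (v_le_iff_valuation_le _ _).2 hVB'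
    calc _ ≤ (Valued.v (toPlace v w (HeckeCharacter.uniformizer ↥(maximalRealSubfield L) v : v.adicCompletion ↥(maximalRealSubfield L))))⁻¹ * Valued.v (toPlace v w (HeckeCharacter.uniformizer ↥(maximalRealSubfield L) v : v.adicCompletion ↥(maximalRealSubfield L))) := mul_le_mul' le_rfl hy
      _ = 1 := inv_mul_cancel₀ hι0
  -- THE FIVE LATTICE COUNTS OF EACH LITERAL IN ITS EIGENFRAME (A1‴)
  have hO := fun b₀ b₁ : Fin 2 =>
    letI := hcpt b₀ b₁
    classOrbitalIntegral_eq_mul_latticeStrata_formCongr_of_vDeep_ramified L H' νG hH' w hw he hH'w hH'i h2 ϖ hϖ hσϖ A hA hframe e hfe hK hmG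
      (tf b₀ b₁) (hregf b₀ b₁) (hdeepf b₀ b₁) g hg hgK hginv (fun _ => c₂) c' (fun r => if IsSquare r then c₁s else c₁n)
      (d := (dO : (w.1.adicCompletion L))) (by rw [hdO]; exact hdv.le) hdd (ε := ε) hεv.le hεsq hc hc'.1 hc'.2
      (fun x z h => by
        obtain ⟨h1, h2', h3, h4, h5⟩ := h
        by_cases hsx : IsSquare (z ⬝ᵥ ((redMat (placeForm H' w.1) * redMat (ϖ⁻¹ • ((((x).val : GL (Fin 3) (UnitaryGroup.LocalRing L v)).val.map (Pi.evalRingHom (fun w' : PlacesOver L v => w'.1.adicCompletion L) w)) - 1))) *ᵥ z))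
        · rw [if_pos hsx]; exact hR4s x z ⟨h1, h2', h3, h4, h5, hsx⟩
        · rw [if_neg hsx]; exact hR4n x z ⟨h1, h2', h3, h4, h5, hsx⟩)
      (fun r a ha => by
        show (if IsSquare (a ^ 2 * r) then c₁s else c₁n) = (if IsSquare r then c₁s else c₁n)
        rw [isSquare_sq_mul_iff_of_ne_zero ha])
      (P b₀ b₁) T (heT b₀ b₁)
  -- THE JUNCTION AT `K := L_w`
  haveI : Fintype (Valued.ResidueField (w.1.adicCompletion L)) := Fintype.ofFinite _
  haveI : Fintype 𝓀[(w.1.adicCompletion L)] := Fintype.ofFinite _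
  obtain ⟨eO, eb, heO, heb⟩ := exists_valuedInteger_ringEquiv (w.1.adicCompletion L)
  have heε : eO εO = ⟨ε, hεVR⟩ := Subtype.ext ((heO εO).trans hεO)
  have hεsqV : ¬ IsSquare (IsLocalRing.residue (Valued.integer (w.1.adicCompletion L)) εO) := fun h => hεsqVR (by
    have h' := h.map eb
    rwa [heb, heε] at h')
  have hJ' := fun j : Fin 5 => hJ (K := (w.1.adicCompletion L)) hσσ hvσ hϖ hσϖ hres h2v hnorm 1 1 (-1) εO dO
    (by simp) (by simp) (by simp) (by rw [hεO]; exact hεv) (by rw [hdO]; exact hdv)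
    (by simp) (by simp) (by simp) (by rw [hεO]; exact hσε) hσd hεsqV
    α (finGammaTwo L v γH w) γ (by rw [mul_comm]; exact hx1' 0) (by rw [mul_comm]; exact hx1' 1) (by rw [mul_comm]; exact hx1' 2)
    hα2 hu2 hγ2 T hT N₁ N₂ N m n hN₁ hN₂ hN' hmN hn h1n AO CO hA' hC' j
  -- (Dict): the sign, and `q`
  have hAVR : (α - (finGammaTwo L v γH w)) / ϖ ^ N₁ ∈ 𝒪[(w.1.adicCompletion L)] := (v_le_one_iff_mem_integer _).1 hAint
  have hCVR : (γ - (finGammaTwo L v γH w)) / ϖ ^ N₂ ∈ 𝒪[(w.1.adicCompletion L)] := (v_le_one_iff_mem_integer _).1 hCint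
  have hβ' : toPlace v w (β : v.adicCompletion ↥(maximalRealSubfield L)) = -(((finGammaTwo L v γH w) - α) * ((finGammaTwo L v γH w) - γ) * ((finGammaTwo L v γH w) ^ 2 + α * γ)) / (2 * (finGammaTwo L v γH w) ^ 2 * (α * γ)) := by
    rw [hβ, hχw, hdetw]
  have hdict := quadraticChar_residue_eq_hilbertSymbol_of_ramified L w hw he h2v ϖ hϖ hσϖ hα1 hu1 hγ1 hN₁ hN₂ hmN ⟨_, hAVR⟩ ⟨_, hCVR⟩
    (by show α - (finGammaTwo L v γH w) = (α - (finGammaTwo L v γH w)) / ϖ ^ N₁ * ϖ ^ N₁; rw [div_mul_cancel₀ _ (pow_ne_zero _ hϖ0)])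
    (by show γ - (finGammaTwo L v γH w) = (γ - (finGammaTwo L v γH w)) / ϖ ^ N₂ * ϖ ^ N₂; rw [div_mul_cancel₀ _ (pow_ne_zero _ hϖ0)]) 1 (-1) rfl rfl β hβ'
  have heA : eO AO = ⟨_, hAVR⟩ := Subtype.ext ((heO AO).trans hAO)
  have heC : eO CO = ⟨_, hCVR⟩ := Subtype.ext ((heO CO).trans hCO)
  have hχ : ((quadraticChar (Valued.ResidueField (w.1.adicCompletion L)) (IsLocalRing.residue (Valued.integer (w.1.adicCompletion L)) ((-1) ^ m * (1 * (-1) * AO * CO))) : ℤ) : ℂ) = (hilbertSymbol (v.adicCompletion ↥(maximalRealSubfield L)) (β : v.adicCompletion ↥(maximalRealSubfield L)) (algebraMap ↥(maximalRealSubfield L) _ ((cmQuadraticGenerator L : 𝓞 ↥(maximalRealSubfield L)) : ↥(maximalRealSubfield L))) : ℂ) := by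
    rw [← hdict, ← quadraticChar_ringEquiv_apply eb, heb]
    simp only [map_mul, map_pow, map_neg, map_one, heA, heC]
  have hq : (Fintype.card (Valued.ResidueField (w.1.adicCompletion L)) : ℂ) = (Ideal.absNorm v.asIdeal : ℂ) := by
    congr 1
    rw [Fintype.card_eq_nat_card, ← natCard_residueField_eq_of_compatible, natCard_residueField_eq_of_ramified (IsCMField.complexConj L) v hc1 w hw he,
      Ideal.absNorm_apply, Submodule.cardQuot_apply]
  -- NORMALISE the four literal equations and the five junction equations to the same atoms
  have hO00 := hO 0 0
  have hO01 := hO 0 1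
  have hO10 := hO 1 0
  have hO11 := hO 1 1
  simp only [hformb, Fin.val_zero, Fin.val_one, pow_zero, pow_one, zero_add, add_zero, Nat.reduceAdd, IsSquare.one, if_true, hεsq, if_false] at hO00 hO01 hO10 hO11
  have hJ0 := hJ' 0
  have hJ1 := hJ' 1
  have hJ2 := hJ' 2
  have hJ3 := hJ' 3
  have hJ4 := hJ' 4
  simp only [Fintype.sum_prod_type, Fin.sum_univ_two, Fin.val_zero, Fin.val_one, pow_zero, pow_one, zero_add, add_zero, Nat.reduceAdd, one_mul, neg_mul,
    OneMemClass.coe_one, mul_one, NegMemClass.coe_neg, mul_neg, hεO, mul_comm ((dO : Valued.integer (w.1.adicCompletion L)) : (w.1.adicCompletion L)) ε,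
    Matrix.cons_val_zero, Matrix.cons_val_one, Matrix.head_cons, Matrix.cons_val_two, Matrix.cons_val_three, Matrix.cons_val_four, Matrix.tail_cons] at hJ0 hJ1 hJ2 hJ3 hJ4
  have hJ0C := congrArg (fun r : ℚ => (r : ℂ)) hJ0
  have hJ1C := congrArg (fun r : ℚ => (r : ℂ)) hJ1
  have hJ2C := congrArg (fun r : ℚ => (r : ℂ)) hJ2
  have hJ3C := congrArg (fun r : ℚ => (r : ℂ)) hJ3
  have hJ4C := congrArg (fun r : ℚ => (r : ℂ)) hJ4
  push_cast at hJ0C hJ1C hJ2C hJ3C hJ4C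
  simp only [one_mul, mul_one, neg_mul, mul_neg] at hχ
  rw [hχ, hq] at hJ0C hJ1C hJ2C hJ3C hJ4C
  simp only [Fin.sum_univ_two, Fin.val_zero, Fin.val_one, pow_zero, pow_one, one_mul, neg_mul]
  linear_combination hO00 - hO01 + hO10 - hO11 + ((νG.real (cmLocalIntegralLevel L 3 H' v : Set ((cmDatum L 3 H').Local v)) : ℝ) : ℂ) *
    (c₂ * hJ0C + c' 2 * hJ1C + c₁s * hJ2C + c₁n * hJ3C + c' 0 * hJ4C)

end SignedClassSum

end Literature.NumberTheory.Rogawski1990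

end
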